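import Summits.NavierStokesRegularity.NavierStokesRegularity.Theorems.ExtremiserTransienceNearExtremalTransienceExtremiserLiouvilleConstantSpeedSlidePalinstrophyDensity
import Summits.NavierStokesRegularity.NavierStokesRegularity.Theorems.ExtremiserTransienceNearExtremalTransienceExtremiserLiouvilleConstantSpeedSlideCurl
import Summits.NavierStokesRegularity.NavierStokesRegularity.Theorems.ExtremiserTransienceNearExtremalTransienceExtremiserLiouvilleConstantSpeedSlideEnstrophy
import Summits.NavierStokesRegularity.NavierStokesRegularity.Theorems.ExtremiserTransienceNearExtremalTransienceExtremiserLiouvilleConstantSpeedEulerLagrange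
import HarnessLib

/-!
# Crux `ExtremiserTransience.NearExtremalTransience` (stmt-NavierStokesRegularity-21883), line `extremiser_liouville`,
# stub K1b — THE STRETCHING DENSITY ALONG THE SLIDE, EXPLICITLY (record §11 identity (S), §14 step R6a-S, pointwise part)

`--supports stmt-NavierStokesRegularity-21883` (helper).  Author: prover seat `ns-el-k1b` (g9).

The last unexpanded term of `slideInequality_explicit` is the stretching variation
`J₁(θ) = ∫(⟪curl θ, DVω⟫ + ⟪ω, Dθ ω⟫ + ⟪ω, DV curl θ⟫)`, `θ = −φ_g`, `φ_g = g∂₂V + g′V_h`.  Pointwise, with `ω = curl V`,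
`P = ∂₂V`, `A = (−2P₁, 2P₀, ω₂)`, `B = (−V₁, V₀, 0)`, `V_h = V − V₂e₂`:
* `fderiv_slideGenerator_apply` : `Dφ_g(x)w = g·∂_w∂₂V + g′w₂·∂₂V + g′·(∂_wV − (∂_wV)₂e₂) + g″w₂·V_h`;
* `stretchingDensity_axial` : `⟪∂₂ω, DVω⟫ + ⟪ω, (∂_ω∂₂V)⟫ + ⟪ω, DV∂₂ω⟫ = ∂₂⟪ω, DVω⟫` (mixed partials);
* `stretchingDensity_slideGenerator` : **the `J₁`-integrand of `φ_g` equals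
  `g(x₂)·∂₂⟪ω,DVω⟫ + g′[⟪A,DVω⟫ + ω₂⟪ω,∂₂V⟫ + ⟪ω, DVω − (DVω)₂e₂⟫ + ⟪ω,DV A⟫] + g″[⟪B,DVω⟫ + ω₂⟪ω,V_h⟫ + ⟪ω,DV B⟫]`**;
* `stretchingDensity_neg` : the `J₁`-integrand is odd: that of `θ = −φ_g` is minus that of `φ_g`.
After the axial rule `∫g∂₂F = −∫g′F` (…SlideKinematics `integral_axialWeight_deriv_mul_eq`) the `g`-part becomes `−∫g′⟪ω,DVω⟫`,
so every term of `J₁` is `g′`/`g″`-weighted and at most quadratic in `DV`, linear in `D²V` — the input of the cubic bound R6a-S.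

WHAT THIS IS NOT: K1b is NOT proved; nothing here proves NS regularity. [folklore]
-/

noncomputable section

open Set Filter Topology MeasureTheory Metric Function InnerProductSpace
open scoped ENNReal NNReal Topology InnerProductSpace RealInnerProductSpace ContDiff
open Literature.Analysis.FluidPDE Literature.Analysis

namespace Summit.NavierStokesRegularity.NavierStokesRegularity.Theorems

-- the problem directory repeats the summit name (`NavierStokesRegularity/NavierStokesRegularity`)
set_option linter.dupNamespace false

namespace ExtremiserLiouville

open DepletionLadder.KStar

variable {V : EuclideanSpace ℝ (Fin 3) → EuclideanSpace ℝ (Fin 3)} {g : ℝ → ℝ}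

/-! ## 1. The derivative of the slide generator -/

/-- `D(V − V₂e₂)(x)w = DV(x)w − (DV(x)w)₂e₂`. [folklore] -/
theorem fderiv_horizontalPart_apply (hVd : Differentiable ℝ V) (x w : EuclideanSpace ℝ (Fin 3)) :
    fderiv ℝ (fun y : EuclideanSpace ℝ (Fin 3) => V y - (V y 2) • EuclideanSpace.single (2 : Fin 3) (1 : ℝ)) x w =
      fderiv ℝ V x w - (fderiv ℝ V x w 2) • EuclideanSpace.single (2 : Fin 3) (1 : ℝ) := by
  have h2 : DifferentiableAt ℝ (fun y : EuclideanSpace ℝ (Fin 3) => V y 2) x :=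
    ((EuclideanSpace.proj (2 : Fin 3) : EuclideanSpace ℝ (Fin 3) →L[ℝ] ℝ).differentiableAt).comp x (hVd x)
  rw [fderiv_fun_sub (hVd x) (h2.smul_const _), fderiv_smul_const h2, sub_apply, ContinuousLinearMap.smulRight_apply,
    fderiv_coord_apply (hVd x) 2 w]

/-- **`Dφ_g(x)w = g(x₂)·∂_w∂₂V + g′(x₂)w₂·∂₂V + g′(x₂)·(∂_wV − (∂_wV)₂e₂) + g″(x₂)w₂·(V − V₂e₂)`**. [folklore] -/
theorem fderiv_slideGenerator_apply (hV : ContDiff ℝ ∞ V) (hg : ContDiff ℝ ∞ g) (x w : EuclideanSpace ℝ (Fin 3)) :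
    fderiv ℝ (fun y : EuclideanSpace ℝ (Fin 3) =>
        g (y 2) • fderiv ℝ V y (EuclideanSpace.single (2 : Fin 3) (1 : ℝ)) +
          deriv g (y 2) • (V y - (V y 2) • EuclideanSpace.single (2 : Fin 3) (1 : ℝ))) x w =
      g (x 2) • fderiv ℝ (fun y => fderiv ℝ V y (EuclideanSpace.single (2 : Fin 3) (1 : ℝ))) x w +
        (deriv g (x 2) * w 2) • fderiv ℝ V x (EuclideanSpace.single (2 : Fin 3) (1 : ℝ)) +
        deriv g (x 2) • (fderiv ℝ V x w - (fderiv ℝ V x w 2) • EuclideanSpace.single (2 : Fin 3) (1 : ℝ)) +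
        (deriv (deriv g) (x 2) * w 2) • (V x - (V x 2) • EuclideanSpace.single (2 : Fin 3) (1 : ℝ)) := by
  set e₂ : EuclideanSpace ℝ (Fin 3) := EuclideanSpace.single (2 : Fin 3) (1 : ℝ) with he₂
  have hVd : Differentiable ℝ V := hV.differentiable (by simp)
  have hgd : Differentiable ℝ g := hg.differentiable (by simp)
  have hγ : ContDiff ℝ ∞ (deriv g) := (contDiff_infty_iff_deriv.mp hg).2
  have hγd : Differentiable ℝ (deriv g) := hγ.differentiable (by simp)
  have hPd : Differentiable ℝ fun y => fderiv ℝ V y e₂ :=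
    ((hV.fderiv_right (m := ∞) (by exact_mod_cast le_rfl)).differentiable (by simp)).clm_apply (differentiable_const e₂)
  have h2 : Differentiable ℝ (fun y : EuclideanSpace ℝ (Fin 3) => V y 2) :=
    (EuclideanSpace.proj (2 : Fin 3) : EuclideanSpace ℝ (Fin 3) →L[ℝ] ℝ).differentiable.comp hVd
  have hWd : Differentiable ℝ fun y : EuclideanSpace ℝ (Fin 3) => V y - (V y 2) • e₂ := hVd.sub (h2.smul_const _)
  have hA : Differentiable ℝ fun y : EuclideanSpace ℝ (Fin 3) => g (y 2) • fderiv ℝ V y e₂ := fun y =>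
    (hasFDerivAt_axialWeight_smul hPd hgd y).differentiableAt
  have hC : Differentiable ℝ fun y : EuclideanSpace ℝ (Fin 3) => deriv g (y 2) • (V y - (V y 2) • e₂) := fun y =>
    (hasFDerivAt_axialWeight_smul hWd hγd y).differentiableAt
  rw [fderiv_fun_add (hA x) (hC x), add_apply, fderiv_axialWeight_smul_apply hPd hgd x w,
    fderiv_axialWeight_smul_apply hWd hγd x w, fderiv_horizontalPart_apply hVd x w]
  abel

/-! ## 2. The axial part is an exact derivative (mixed partials) -/

/-- **`⟪∂₂ω, DVω⟫ + ⟪ω, ∂_ω(∂₂V)⟫ + ⟪ω, DV ∂₂ω⟫ = ∂₂⟪ω, DVω⟫`** (`∂_ω∂₂V = ∂₂∂_ωV` by symmetry of `D²V`). [folklore] -/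
theorem stretchingDensity_axial (hV : ContDiff ℝ ∞ V) (x : EuclideanSpace ℝ (Fin 3)) :
    ⟪fderiv ℝ (curl V) x (EuclideanSpace.single (2 : Fin 3) (1 : ℝ)), fderiv ℝ V x (curl V x)⟫ +
        ⟪curl V x, fderiv ℝ (fun y => fderiv ℝ V y (EuclideanSpace.single (2 : Fin 3) (1 : ℝ))) x (curl V x)⟫ +
        ⟪curl V x, fderiv ℝ V x (fderiv ℝ (curl V) x (EuclideanSpace.single (2 : Fin 3) (1 : ℝ)))⟫ =
      fderiv ℝ (fun y : EuclideanSpace ℝ (Fin 3) => ⟪curl V y, fderiv ℝ V y (curl V y)⟫) x (EuclideanSpace.single (2 : Fin 3) (1 : ℝ)) := by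
  set e₂ : EuclideanSpace ℝ (Fin 3) := EuclideanSpace.single (2 : Fin 3) (1 : ℝ) with he₂
  have hV2 : ContDiff ℝ 2 V := hV.of_le (WithTop.coe_le_coe.mpr le_top)
  have hVd : Differentiable ℝ V := hV.differentiable (by simp)
  have hω : ContDiff ℝ ∞ (curl V) := contDiff_curl (n := ⊤) (hV.of_le (by exact_mod_cast le_top))
  have hωd : Differentiable ℝ (curl V) := hω.differentiable (by simp)
  have hDd : Differentiable ℝ (fderiv ℝ V) := (hV.fderiv_right (m := ∞) (by exact_mod_cast le_rfl)).differentiable (by simp)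
  -- `y ↦ DV(y)(ω(y))`
  have hc : HasFDerivAt (fun y => fderiv ℝ V y (curl V y))
      ((fderiv ℝ V x).comp (fderiv ℝ (curl V) x) + (fderiv ℝ (fderiv ℝ V) x).flip (curl V x)) x :=
    (hDd x).hasFDerivAt.clm_apply (hωd x).hasFDerivAt
  have hi := ((hωd x).hasFDerivAt).inner ℝ hc
  rw [hi.fderiv]
  simp only [fderivInnerCLM_apply, ContinuousLinearMap.prod_apply, add_apply, ContinuousLinearMap.coe_comp,
    Function.comp_apply, ContinuousLinearMap.flip_apply]
  -- `(D(DV)(x) e₂)(ω) = ∂_ω∂₂V = D(y ↦ DV y e₂)(x) ω` by symmetry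
  have hsym : fderiv ℝ (fderiv ℝ V) x e₂ (curl V x) = fderiv ℝ (fun y => fderiv ℝ V y e₂) x (curl V x) := by
    rw [fderiv_apply_comm_const (hDd x), fderiv_fderiv_apply_comm_vec hV2 x (curl V x) e₂]
  rw [hsym, real_inner_comm (fderiv ℝ V x (curl V x)), inner_add_right]
  ring

/-! ## 3. The stretching density of the slide generator -/

/-- **Identity (S), pointwise**: the `J₁`-integrand of `φ_g = g∂₂V + g′V_h` is
`g·∂₂⟪ω,DVω⟫ + g′[⟪A,DVω⟫ + ω₂⟪ω,∂₂V⟫ + ⟪ω, DVω − (DVω)₂e₂⟫ + ⟪ω,DV A⟫] + g″[⟪B,DVω⟫ + ω₂⟪ω,V_h⟫ + ⟪ω,DV B⟫]`,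
`A = (−2∂₂V₁, 2∂₂V₀, ω₂)`, `B = (−V₁, V₀, 0)`, `V_h = V − V₂e₂`. [folklore] -/
theorem stretchingDensity_slideGenerator (hV : ContDiff ℝ ∞ V) (hg : ContDiff ℝ ∞ g) (x : EuclideanSpace ℝ (Fin 3)) :
    ⟪curl (fun y : EuclideanSpace ℝ (Fin 3) => g (y 2) • fderiv ℝ V y (EuclideanSpace.single (2 : Fin 3) (1 : ℝ)) + deriv g (y 2) • (V y - (V y 2) • EuclideanSpace.single (2 : Fin 3) (1 : ℝ))) x, fderiv ℝ V x (curl V x)⟫ +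
        ⟪curl V x, fderiv ℝ (fun y : EuclideanSpace ℝ (Fin 3) => g (y 2) • fderiv ℝ V y (EuclideanSpace.single (2 : Fin 3) (1 : ℝ)) + deriv g (y 2) • (V y - (V y 2) • EuclideanSpace.single (2 : Fin 3) (1 : ℝ))) x (curl V x)⟫ +
        ⟪curl V x, fderiv ℝ V x (curl (fun y : EuclideanSpace ℝ (Fin 3) => g (y 2) • fderiv ℝ V y (EuclideanSpace.single (2 : Fin 3) (1 : ℝ)) + deriv g (y 2) • (V y - (V y 2) • EuclideanSpace.single (2 : Fin 3) (1 : ℝ))) x)⟫ =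
      g (x 2) * fderiv ℝ (fun y : EuclideanSpace ℝ (Fin 3) => ⟪curl V y, fderiv ℝ V y (curl V y)⟫) x (EuclideanSpace.single (2 : Fin 3) (1 : ℝ)) +
        deriv g (x 2) *
          (⟪((-2 * fderiv ℝ V x (EuclideanSpace.single (2 : Fin 3) (1 : ℝ)) 1) • EuclideanSpace.single (0 : Fin 3) (1 : ℝ) + (2 * fderiv ℝ V x (EuclideanSpace.single (2 : Fin 3) (1 : ℝ)) 0) • EuclideanSpace.single (1 : Fin 3) (1 : ℝ) + (curl V x 2) • EuclideanSpace.single (2 : Fin 3) (1 : ℝ)), fderiv ℝ V x (curl V x)⟫ +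
            curl V x 2 * ⟪curl V x, fderiv ℝ V x (EuclideanSpace.single (2 : Fin 3) (1 : ℝ))⟫ +
            ⟪curl V x, fderiv ℝ V x (curl V x) - (fderiv ℝ V x (curl V x) 2) • EuclideanSpace.single (2 : Fin 3) (1 : ℝ)⟫ +
            ⟪curl V x, fderiv ℝ V x ((-2 * fderiv ℝ V x (EuclideanSpace.single (2 : Fin 3) (1 : ℝ)) 1) • EuclideanSpace.single (0 : Fin 3) (1 : ℝ) + (2 * fderiv ℝ V x (EuclideanSpace.single (2 : Fin 3) (1 : ℝ)) 0) • EuclideanSpace.single (1 : Fin 3) (1 : ℝ) + (curl V x 2) • EuclideanSpace.single (2 : Fin 3) (1 : ℝ))⟫) +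
        deriv (deriv g) (x 2) *
          (⟪((-V x 1) • EuclideanSpace.single (0 : Fin 3) (1 : ℝ) + (V x 0) • EuclideanSpace.single (1 : Fin 3) (1 : ℝ)), fderiv ℝ V x (curl V x)⟫ +
            curl V x 2 * ⟪curl V x, V x - (V x 2) • EuclideanSpace.single (2 : Fin 3) (1 : ℝ)⟫ +
            ⟪curl V x, fderiv ℝ V x ((-V x 1) • EuclideanSpace.single (0 : Fin 3) (1 : ℝ) + (V x 0) • EuclideanSpace.single (1 : Fin 3) (1 : ℝ))⟫) := by
  have hV2 : ContDiff ℝ 2 V := hV.of_le (WithTop.coe_le_coe.mpr le_top)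
  have hg2 : ContDiff ℝ 2 g := hg.of_le (WithTop.coe_le_coe.mpr le_top)
  rw [curl_slideGenerator_eq hV2 hg2 x, curl_fderiv_apply_comm hV2 x (EuclideanSpace.single (2 : Fin 3) (1 : ℝ)),
    fderiv_slideGenerator_apply hV hg x (curl V x), ← stretchingDensity_axial hV x]
  simp only [inner_add_left, inner_add_right, inner_smul_left, inner_smul_right, map_add, map_smul, conj_trivial]
  ring

/-- The `J₁`-integrand is odd in the direction: that of `−φ` is minus that of `φ`. [folklore] -/
theorem stretchingDensity_neg (φ : EuclideanSpace ℝ (Fin 3) → EuclideanSpace ℝ (Fin 3)) (x : EuclideanSpace ℝ (Fin 3)) :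
    ⟪curl (fun y => -φ y) x, fderiv ℝ V x (curl V x)⟫ + ⟪curl V x, fderiv ℝ (fun y => -φ y) x (curl V x)⟫ +
        ⟪curl V x, fderiv ℝ V x (curl (fun y => -φ y) x)⟫ =
      -(⟪curl φ x, fderiv ℝ V x (curl V x)⟫ + ⟪curl V x, fderiv ℝ φ x (curl V x)⟫ + ⟪curl V x, fderiv ℝ V x (curl φ x)⟫) := by
  rw [curl_neg_apply, fderiv_fun_neg]
  simp only [inner_neg_left, inner_neg_right, neg_apply, map_neg]
  ring

end ExtremiserLiouville

end Summit.NavierStokesRegularity.NavierStokesRegularity.Theorems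

end
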